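import Literature.NumberTheory.EllipticCurves.FormalGroupPClosedLeafProofs
import Literature.NumberTheory.EllipticCurves.FormalGroupLawAxiomsUniversalProofs
import Literature.NumberTheory.EllipticCurves.GlobalMinimalModel
import Literature.NumberTheory.EllipticCurves.PointCountHasseInvariantProofs
import HarnessLib

/-!
# Denominators of the formal leaf `y = exp_{E'}(log_E x)`: `n!·[xⁿ]f(x, y(x)) ∈ p^{⌊n/p⌋}ℤ`
at a prime where the Hasse invariants agree (Bost 2001, Prop. 3.9 (2); proofs only)

Topic `Literature/NumberTheory/EllipticCurves`; a proofs-only file (theorems only, no definition,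
no named fact). This is the characteristic-zero half of the `p`-adic input of Bost's
Faltings-free proof of the isogeny theorem for elliptic curves over `ℚ` (J.-B. Bost, Publ. Math.
IHÉS 93 (2001), Cor. 2.5), serving the tree's named fact
`WeierstrassCurve.isIsogenous_iff_frobeniusTrace_eq`. For two Weierstrass equations `W, W'` over
`ℤ` let

* `y(x) = exp_{W'}(log_W(x)) ∈ ℚ⟦x⟧` — the strict isomorphism `Ê_ℚ → Ê'_ℚ` of the formal groups
  over `ℚ`, i.e. the formal leaf through the origin of the line `h ⊂ Lie E ⊕ Lie E'` spanned by
  `D + D'` (Bost, proof of Cor. 2.5); in the parameters `zᵢ = -xᵢ/yᵢ`, `z₂ = y(z₁)`;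
* `σ f = f(x, y(x)) ∈ ℚ⟦x⟧` for `f ∈ ℤ⟦x₀, x₁⟧` (`MvPowerSeries.subst ![X, y] (f.map ℚ)`);
* `ξ = ∂/∂x₀ + ω(x₀)η'(x₁)∂/∂x₁` the normalised generator (`FormalGroupPClosedLeafProofs`).

Then (Bost, Prop. 3.9 and its proof, pp. 192–193, with `d = 2`, `f = 1`, `K = ℚ`):

* `derivative_formalExp`, `derivative_formalExp_subst_formalLog` — `y' = ω(x)·η'(y)`
  (`log_{W'}(y) = log_W(x)` differentiated; AEC IV.5);
* `derivative_leafSubst` — **the flow equation** `d/dx (σ f) = σ(ξ f)`, hence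
  `(d/dx)ⁿ(σ f) = σ(ξⁿ f)` (`iterate_derivative_leafSubst`; Bost's "Taylor formula" (3.7));
* `map_leafDerivation` — `ξ` commutes with base change; so by `ξᵖ ≡ 0 (mod p)`
  (`iterate_prime_leafDerivation_eq_zero` over `𝔽_p`) `ξᵖ f ∈ p·ℤ⟦x₀,x₁⟧` and
  `ξⁿ f ∈ p^{⌊n/p⌋}ℤ⟦x₀,x₁⟧` (`exists_iterate_leafDerivation_eq_pow_smul`; Bost p. 193: "the
  differential operators `Dᵢᵖ` map `𝒪⟦x⟧` to `ϖ𝒪⟦x⟧` … `D^I(X) ∈ ϖ^{Σ[iⱼ/p]}𝒪⟦x⟧`");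
* `exists_int_factorial_mul_coeff_leafSubst` — **`n!·[xⁿ]σf = p^{⌊n/p⌋}·m`, `m ∈ ℤ`**, for an odd
  prime `p` at which the Hasse invariants of `W mod p`, `W' mod p` agree; and
  `exists_int_factorial_mul_coeff_leafSubst'` — `n!·[xⁿ]σf ∈ ℤ` at every `n` unconditionally
  (Bost, Prop. 3.9 (1): "`D^I(X) ∈ 𝒪⟦x⟧`"); `exists_int_factorial_mul_coeff_pow` — the case
  `f = x₁ʲ`, i.e. the coefficients of the powers `yʲ`;
* `intCast_frobeniusTrace_eq_hasseCoeff` — the hypothesis in terms of `a_p`: for a globally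
  minimal `W₀/ℚ` and an odd prime `p` at which the reduction is nonsingular,
  `a_p(W₀) ≡ A_p (mod p)` (Silverman AEC V.4.1(a); the tree's
  `cast_card_add_one_sub_natCard_point`), so `a_p(E) = a_p(E')` gives the Hasse hypothesis.

Consequence for the algebraicity criterion (Bost Thm. 2.1/3.4, André 2004 Thm. 5.4.3): the
denominator of `[xⁿ](yʲ)` divides `n!/∏_{p ∉ S} p^{⌊n/p⌋}` for the finite set `S` of primes that
are `2`, or divide `Δ(W)Δ(W')`, or have `a_p ≠ a'_p`; its logarithm is `O(n)`.

## References

* J.-B. Bost, *Algebraic leaves of algebraic foliations over number fields*, Publ. Math. IHÉS 93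
  (2001): Cor. 2.5 (proof, p. 173), §3.4.1 (3.5)–(3.8), Prop. 3.9 and its proof (pp. 192–193).
  [Bost2001AlgebraicLeaves]
* J. H. Silverman, *AEC* 2nd ed. (2009), IV.1, IV.4–IV.5 (formal logarithm/exponential),
  V.4.1(a) (`a_p ≡ A_p`). [SilvermanAEC2009]
-/

noncomputable section

open PowerSeries Finset Literature.RingTheory.FormalGroups Literature.NumberTheory.EllipticCurves
open Literature.AlgebraicGeometry.Resolution (MvPowerSeries.pderiv MvPowerSeries.coeff_pderiv
  MvPowerSeries.pderiv_X MvPowerSeries.pderiv_C MvPowerSeries.pderiv_powerSeries_subst_X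
  MvPowerSeries.pderiv_subst_pair MvPowerSeries.pderiv_unit_eq_derivative)

namespace WeierstrassCurve

/-! ### `y = exp_{W'}(log_W x)` and its derivative -/

section RatAlgebra

variable {A : Type*} [CommRing A] [Algebra ℚ A] (V V' : WeierstrassCurve A)

/-- `exp_V` is substitutable (`exp_V(0) = 0`). [folklore] -/
theorem hasSubst_formalExp : HasSubst V.formalExp :=
  HasSubst.of_constantCoeff_zero' V.constantCoeff_formalExp

/-- **`(exp_V)' = η(exp_V)`**: differentiate `log_V(exp_V(z)) = z`, `log_V' = ω`, `ωη = 1`.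
[Silverman AEC IV.5 (formal logarithm and exponential)] [folklore] -/
theorem derivative_formalExp : d⁄dX A V.formalExp = V.formalEta.subst V.formalExp := by
  have hs := V.hasSubst_formalExp
  have h := congrArg (d⁄dX A) V.formalLog_subst_formalExp
  rw [derivative_subst A hs, derivative_formalLog, derivative_X] at h
  have h1 : V.formalEta.subst V.formalExp * V.formalOmega.subst V.formalExp = 1 := by
    rw [← subst_mul hs, formalEta_mul_formalOmega, ← coe_substAlgHom hs, map_one]
  rw [← one_mul (d⁄dX A V.formalExp), ← h1, mul_assoc, h, mul_one]

/-- `y = exp_{V'}(log_V x)` has zero constant term. [folklore] -/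
theorem constantCoeff_formalExp_subst_formalLog :
    constantCoeff (V'.formalExp.subst V.formalLog) = 0 :=
  constantCoeff_subst_eq_zero V.constantCoeff_formalLog _ V'.constantCoeff_formalExp

/-- **`log_{V'}(y) = log_V(x)`** for `y = exp_{V'}(log_V x)`. [Silverman AEC IV.5] [folklore] -/
theorem formalLog_subst_formalExp_subst_formalLog :
    V'.formalLog.subst (V'.formalExp.subst V.formalLog) = V.formalLog := by
  rw [← subst_comp_subst_apply V'.hasSubst_formalExp V.hasSubst_formalLog,
    formalLog_subst_formalExp, subst_X V.hasSubst_formalLog]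

/-- **`y' = ω(x)·η'(y)`** for `y = exp_{V'}(log_V x)` (`ω = ω_V`, `η' = 1/ω_{V'}`): the leaf is
the flow of `∂ₓ + ω(x)η'(y)∂_y`. [cite: Bost2001AlgebraicLeaves, §3.4.1 (3.6)] -/
theorem derivative_formalExp_subst_formalLog :
    d⁄dX A (V'.formalExp.subst V.formalLog) =
      V.formalOmega * V'.formalEta.subst (V'.formalExp.subst V.formalLog) := by
  rw [derivative_subst A V.hasSubst_formalLog, derivative_formalExp, derivative_formalLog,
    subst_comp_subst_apply V'.hasSubst_formalExp V.hasSubst_formalLog, mul_comm]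

/-! ### `σ f = f(x, y(x))` and the flow equation `(σ f)' = σ(ξ f)` -/

omit [Algebra ℚ A] in
/-- `![x, y]` is substitutable when `y(0) = 0`. [folklore] -/
theorem _root_.Literature.NumberTheory.EllipticCurves.hasSubst_X_cons_of_constantCoeff (y : A⟦X⟧)
    (hy : constantCoeff y = 0) : MvPowerSeries.HasSubst ![(X : A⟦X⟧), y] :=
  MvPowerSeries.hasSubst_of_constantCoeff_zero fun i => by
    fin_cases i
    · exact constantCoeff_X (R := A)
    · exact hy

/-- `g(xᵢ)` after `(x₀, x₁) ↦ (a₀, a₁)` is `g(aᵢ)`. [folklore] -/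
theorem _root_.Literature.NumberTheory.EllipticCurves.subst_pair_subst_X {R : Type*} [CommRing R]
    {τ : Type*} {a : Fin 2 → MvPowerSeries τ R} (ha : MvPowerSeries.HasSubst a) (i : Fin 2)
    (g : R⟦X⟧) :
    MvPowerSeries.subst a (g.subst (MvPowerSeries.X i : MvPowerSeries (Fin 2) R)) = g.subst (a i) := by
  simp only [subst_def]
  rw [MvPowerSeries.subst_comp_subst_apply (HasSubst.const (HasSubst.X i)) ha]
  congr 1
  funext u
  exact MvPowerSeries.subst_X ha i

/-- **The flow equation `(σ f)' = σ(ξ f)`**: for `y = exp_{V'}(log_V x)` and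
`σ f = f(x, y(x))`, `d/dx (σ f) = σ(∂₀f + ω(x₀)η'(x₁)∂₁f)` — the chain rule and `y' = ω(x)η'(y)`.
[cite: Bost2001AlgebraicLeaves, §3.4.1 (3.6)–(3.7)] -/
theorem derivative_leafSubst (F : MvPowerSeries (Fin 2) A) :
    d⁄dX A (MvPowerSeries.subst ![(X : A⟦X⟧), V'.formalExp.subst V.formalLog] F) =
      MvPowerSeries.subst ![(X : A⟦X⟧), V'.formalExp.subst V.formalLog]
        ((V.formalInvDiff.subst (MvPowerSeries.X 0 : MvPowerSeries (Fin 2) A) •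
          (V.formalInvariantDerivationMv (0 : Fin 2) + V'.formalInvariantDerivationMv (1 : Fin 2))) F) := by
  have hy0 : constantCoeff (V'.formalExp.subst V.formalLog) = 0 :=
    V.constantCoeff_formalExp_subst_formalLog V'
  have ha := hasSubst_X_cons_of_constantCoeff _ hy0
  rw [leafDerivation_apply, ← MvPowerSeries.coe_substAlgHom ha, map_add, map_mul, map_mul,
    MvPowerSeries.coe_substAlgHom ha, subst_pair_subst_X ha, subst_pair_subst_X ha]
  simp only [Matrix.cons_val_zero, Matrix.cons_val_one]
  rw [X_subst, formalInvDiff_eq_formalOmega, ← MvPowerSeries.pderiv_unit_eq_derivative,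
    MvPowerSeries.pderiv_subst_pair constantCoeff_X hy0, MvPowerSeries.pderiv_unit_eq_derivative,
    MvPowerSeries.pderiv_unit_eq_derivative, derivative_X, derivative_formalExp_subst_formalLog]
  ring

/-- Iterating: `(d/dx)ⁿ(σ f) = σ(ξⁿ f)` (Bost's Taylor formula (3.7) for the leaf).
[cite: Bost2001AlgebraicLeaves, §3.4.1 (3.7)] -/
theorem iterate_derivative_leafSubst (F : MvPowerSeries (Fin 2) A) (n : ℕ) :
    (d⁄dX A)^[n] (MvPowerSeries.subst ![(X : A⟦X⟧), V'.formalExp.subst V.formalLog] F) =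
      MvPowerSeries.subst ![(X : A⟦X⟧), V'.formalExp.subst V.formalLog]
        ((⇑(V.formalInvDiff.subst (MvPowerSeries.X 0 : MvPowerSeries (Fin 2) A) •
          (V.formalInvariantDerivationMv (0 : Fin 2) + V'.formalInvariantDerivationMv (1 : Fin 2))))^[n]
          F) := by
  induction n generalizing F with
  | zero => rfl
  | succ n ih => rw [Function.iterate_succ_apply, Function.iterate_succ_apply, ← ih,
      derivative_leafSubst]

/-- `σ` preserves constant terms: `(σ f)(0) = f(0, 0)`. [folklore] -/
theorem constantCoeff_leafSubst (F : MvPowerSeries (Fin 2) A) :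
    constantCoeff (MvPowerSeries.subst ![(X : A⟦X⟧), V'.formalExp.subst V.formalLog] F : A⟦X⟧) =
      MvPowerSeries.constantCoeff F := by
  have hy0 := V.constantCoeff_formalExp_subst_formalLog V'
  have ha := hasSubst_X_cons_of_constantCoeff _ hy0
  have ha' : ∀ i, MvPowerSeries.constantCoeff (![(X : A⟦X⟧), V'.formalExp.subst V.formalLog] i) = 0 :=
    fun i => by fin_cases i; exacts [constantCoeff_X, hy0]
  set c := MvPowerSeries.constantCoeff F
  have hF : F = MvPowerSeries.C c + (F - MvPowerSeries.C c) := by ring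
  rw [hF, ← MvPowerSeries.coe_substAlgHom ha, map_add, MvPowerSeries.coe_substAlgHom ha,
    MvPowerSeries.subst_C]
  change MvPowerSeries.constantCoeff _ = _
  rw [map_add, MvPowerSeries.constantCoeff_subst_eq_zero ha ha' (by simp [c]),
    MvPowerSeries.constantCoeff_C, add_zero]

omit [Algebra ℚ A] in
/-- `n!·[xⁿ]g = ((d/dx)ⁿ g)(0)`. [folklore] -/
theorem _root_.Literature.NumberTheory.EllipticCurves.factorial_mul_coeff_eq_constantCoeff_iterate
    (g : A⟦X⟧) (n : ℕ) :
    (n.factorial : A) * coeff n g = constantCoeff ((d⁄dX A)^[n] g) := by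
  rw [← coeff_zero_eq_constantCoeff_apply, coeff_iterate_derivative, zero_add, Nat.one_ascFactorial,
    zero_add]

end RatAlgebra

/-! ### `ξ` commutes with base change; `ξⁿ f ∈ p^{⌊n/p⌋} ℤ⟦x₀, x₁⟧` -/

section Map

variable {R S : Type*} [CommRing R] [CommRing S] (φ : R →+* S)

/-- `∂ᵢ` commutes with `map`. [folklore] -/
theorem _root_.Literature.NumberTheory.EllipticCurves.map_pderiv {σ : Type*} (i : σ)
    (f : MvPowerSeries σ R) :
    MvPowerSeries.map φ (MvPowerSeries.pderiv i f) = MvPowerSeries.pderiv i (MvPowerSeries.map φ f) := by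
  ext e
  simp [MvPowerSeries.coeff_map, MvPowerSeries.coeff_pderiv]

/-- `g(xᵢ)` commutes with `map`. [folklore] -/
theorem _root_.Literature.NumberTheory.EllipticCurves.map_subst_X {σ : Type*} (i : σ) (g : R⟦X⟧) :
    MvPowerSeries.map φ (g.subst (MvPowerSeries.X i : MvPowerSeries σ R)) =
      (g.map φ).subst (MvPowerSeries.X i : MvPowerSeries σ S) := by
  rw [map_subst (HasSubst.X i), MvPowerSeries.map_X]

/-- **`ξ` commutes with base change**: `map φ (ξ_{W,W'} f) = ξ_{φW, φW'} (map φ f)`. [folklore] -/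
theorem map_leafDerivation (W W' : WeierstrassCurve R) (f : MvPowerSeries (Fin 2) R) :
    MvPowerSeries.map φ ((W.formalInvDiff.subst (MvPowerSeries.X 0 : MvPowerSeries (Fin 2) R) •
        (W.formalInvariantDerivationMv (0 : Fin 2) + W'.formalInvariantDerivationMv (1 : Fin 2))) f) =
      ((W.map φ).formalInvDiff.subst (MvPowerSeries.X 0 : MvPowerSeries (Fin 2) S) •
        ((W.map φ).formalInvariantDerivationMv (0 : Fin 2) +
          (W'.map φ).formalInvariantDerivationMv (1 : Fin 2))) (MvPowerSeries.map φ f) := by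
  rw [leafDerivation_apply, leafDerivation_apply, map_add, map_mul, map_mul, map_pderiv, map_pderiv,
    map_subst_X, map_subst_X, W.map_formalInvDiff φ, W'.map_formalEta φ]

/-- Iterates: `map φ (ξⁿ f) = ξⁿ (map φ f)`. [folklore] -/
theorem map_iterate_leafDerivation (W W' : WeierstrassCurve R) (f : MvPowerSeries (Fin 2) R) (n : ℕ) :
    MvPowerSeries.map φ ((⇑(W.formalInvDiff.subst (MvPowerSeries.X 0 : MvPowerSeries (Fin 2) R) •
        (W.formalInvariantDerivationMv (0 : Fin 2) + W'.formalInvariantDerivationMv (1 : Fin 2))))^[n] f) =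
      (⇑((W.map φ).formalInvDiff.subst (MvPowerSeries.X 0 : MvPowerSeries (Fin 2) S) •
        ((W.map φ).formalInvariantDerivationMv (0 : Fin 2) +
          (W'.map φ).formalInvariantDerivationMv (1 : Fin 2))))^[n] (MvPowerSeries.map φ f) := by
  induction n generalizing f with
  | zero => rfl
  | succ n ih => rw [Function.iterate_succ_apply, Function.iterate_succ_apply, ← map_leafDerivation, ih]

end Map

section Int

variable (p : ℕ) [Fact p.Prime]

/-- A series over `ℤ` whose reduction modulo `p` vanishes is `p` times a series. [folklore] -/
theorem _root_.Literature.NumberTheory.EllipticCurves.exists_eq_prime_smul_of_map_eq_zero {σ : Type*}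
    (F : MvPowerSeries σ ℤ) (hF : MvPowerSeries.map (Int.castRingHom (ZMod p)) F = 0) :
    ∃ G : MvPowerSeries σ ℤ, F = (p : ℤ) • G := by
  have hdvd : ∀ e, (p : ℤ) ∣ MvPowerSeries.coeff e F := fun e => by
    rw [← ZMod.intCast_zmod_eq_zero_iff_dvd]
    have := congrArg (MvPowerSeries.coeff e) hF
    rwa [MvPowerSeries.coeff_map, eq_intCast, map_zero] at this
  refine ⟨fun e => MvPowerSeries.coeff e F / p, ?_⟩
  ext e
  rw [map_zsmul, smul_eq_mul]
  change _ = (p : ℤ) * (MvPowerSeries.coeff e F / p)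
  exact (Int.mul_ediv_cancel' (hdvd e)).symm

variable (W W' : WeierstrassCurve ℤ)

/-- **`ξᵖ f ∈ p·ℤ⟦x₀, x₁⟧`** for an odd prime `p` at which the Hasse invariants of `W mod p` and
`W' mod p` agree: reduce modulo `p` and use `ξᵖ = 0` there. [cite: Bost2001AlgebraicLeaves,
Prop. 3.9 (2) (proof, p. 193)] -/
theorem exists_iterate_prime_leafDerivation_eq_smul (hp2 : p ≠ 2)
    (hA : (W.map (Int.castRingHom (ZMod p))).hasseCoeff p =
      (W'.map (Int.castRingHom (ZMod p))).hasseCoeff p)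
    (f : MvPowerSeries (Fin 2) ℤ) :
    ∃ g : MvPowerSeries (Fin 2) ℤ,
      (⇑(W.formalInvDiff.subst (MvPowerSeries.X 0 : MvPowerSeries (Fin 2) ℤ) •
        (W.formalInvariantDerivationMv (0 : Fin 2) + W'.formalInvariantDerivationMv (1 : Fin 2))))^[p] f =
        (p : ℤ) • g := by
  apply exists_eq_prime_smul_of_map_eq_zero
  rw [map_iterate_leafDerivation, iterate_prime_leafDerivation_eq_zero hp2 _ _ hA]

/-- **`ξⁿ f ∈ p^{⌊n/p⌋}·ℤ⟦x₀, x₁⟧`** (`p` odd, Hasse invariants agree mod `p`).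
[cite: Bost2001AlgebraicLeaves, Prop. 3.9 (2) (proof, p. 193)] -/
theorem exists_iterate_leafDerivation_eq_pow_smul (hp2 : p ≠ 2)
    (hA : (W.map (Int.castRingHom (ZMod p))).hasseCoeff p =
      (W'.map (Int.castRingHom (ZMod p))).hasseCoeff p)
    (n : ℕ) (f : MvPowerSeries (Fin 2) ℤ) :
    ∃ g : MvPowerSeries (Fin 2) ℤ,
      (⇑(W.formalInvDiff.subst (MvPowerSeries.X 0 : MvPowerSeries (Fin 2) ℤ) •
        (W.formalInvariantDerivationMv (0 : Fin 2) + W'.formalInvariantDerivationMv (1 : Fin 2))))^[n] f =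
        (p : ℤ) ^ (n / p) • g := by
  suffices h : ∀ (q r : ℕ) (f : MvPowerSeries (Fin 2) ℤ), ∃ g : MvPowerSeries (Fin 2) ℤ,
      (⇑(W.formalInvDiff.subst (MvPowerSeries.X 0 : MvPowerSeries (Fin 2) ℤ) •
        (W.formalInvariantDerivationMv (0 : Fin 2) + W'.formalInvariantDerivationMv (1 : Fin 2))))^[p * q + r]
          f = (p : ℤ) ^ q • g by
    obtain ⟨g, hg⟩ := h (n / p) (n % p) f
    rw [Nat.div_add_mod] at hg
    exact ⟨g, hg⟩
  intro q
  induction q with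
  | zero => intro r f; exact ⟨_, by rw [mul_zero, zero_add, pow_zero, one_smul]⟩
  | succ q ih =>
    intro r f
    obtain ⟨g₁, hg₁⟩ := exists_iterate_prime_leafDerivation_eq_smul p W W' hp2 hA f
    obtain ⟨g₂, hg₂⟩ := ih r g₁
    refine ⟨g₂, ?_⟩
    rw [show p * (q + 1) + r = (p * q + r) + p by ring, Function.iterate_add_apply, hg₁,
      iterate_map_zsmul, hg₂, smul_smul, pow_succ, mul_comm]

/-- **`n!·[xⁿ] f(x, y(x)) = p^{⌊n/p⌋}·m` with `m ∈ ℤ`** — the denominators of the formal leaf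
`y = exp_{W'}(log_W x) ∈ ℚ⟦x⟧` of two Weierstrass equations `W, W'` over `ℤ` at an odd prime `p`
where the Hasse invariants of the reductions agree (e.g. `a_p(W) ≡ a_p(W') (mod p)`, see
`intCast_frobeniusTrace_eq_hasseCoeff`): for every `f ∈ ℤ⟦x₀, x₁⟧` and `n`,
`n!·[xⁿ]σf ∈ p^{⌊n/p⌋}ℤ`. Bost's Prop. 3.9 (2) for the foliation of `E × E'` by `h`
(`d = 2`, `f = 1`): `(1/I!)·D^I(X)(0)` has `p`-adic absolute value `≤ p^{(i - S(i))/(p-1) - ⌊i/p⌋}`.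
[cite: Bost2001AlgebraicLeaves, Prop. 3.9 (2)] -/
theorem exists_int_factorial_mul_coeff_leafSubst (hp2 : p ≠ 2)
    (hA : (W.map (Int.castRingHom (ZMod p))).hasseCoeff p =
      (W'.map (Int.castRingHom (ZMod p))).hasseCoeff p)
    (f : MvPowerSeries (Fin 2) ℤ) (n : ℕ) :
    ∃ m : ℤ, (n.factorial : ℚ) *
        coeff n (MvPowerSeries.subst
          ![(X : ℚ⟦X⟧), (W'.map (Int.castRingHom ℚ)).formalExp.subst (W.map (Int.castRingHom ℚ)).formalLog]
          (MvPowerSeries.map (Int.castRingHom ℚ) f) : ℚ⟦X⟧) = (p : ℚ) ^ (n / p) * m := by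
  obtain ⟨g, hg⟩ := exists_iterate_leafDerivation_eq_pow_smul p W W' hp2 hA n f
  refine ⟨MvPowerSeries.constantCoeff g, ?_⟩
  rw [factorial_mul_coeff_eq_constantCoeff_iterate, iterate_derivative_leafSubst,
    constantCoeff_leafSubst, ← map_iterate_leafDerivation, hg, map_zsmul, map_zsmul,
    MvPowerSeries.constantCoeff_map, eq_intCast, zsmul_eq_mul, Int.cast_pow, Int.cast_natCast]

/-- **`n!·[xⁿ] f(x, y(x)) ∈ ℤ` for every `n`**, unconditionally (any two Weierstrass equations
over `ℤ`, any `f ∈ ℤ⟦x₀, x₁⟧`): `(d/dx)ⁿ σf = σ(ξⁿ f)` has integral constant term. This is Bost's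
Prop. 3.9 (1) ("`D^I(X) ∈ 𝒪⟦x⟧`", whence `p`-adic radius `≥ |p|^{1/(p-1)}` at every `p`).
[cite: Bost2001AlgebraicLeaves, Prop. 3.9 (1)] -/
theorem exists_int_factorial_mul_coeff_leafSubst' (f : MvPowerSeries (Fin 2) ℤ) (n : ℕ) :
    ∃ m : ℤ, (n.factorial : ℚ) *
        coeff n (MvPowerSeries.subst
          ![(X : ℚ⟦X⟧), (W'.map (Int.castRingHom ℚ)).formalExp.subst (W.map (Int.castRingHom ℚ)).formalLog]
          (MvPowerSeries.map (Int.castRingHom ℚ) f) : ℚ⟦X⟧) = m := by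
  refine ⟨MvPowerSeries.constantCoeff ((⇑(W.formalInvDiff.subst (MvPowerSeries.X 0 : MvPowerSeries (Fin 2) ℤ) •
        (W.formalInvariantDerivationMv (0 : Fin 2) + W'.formalInvariantDerivationMv (1 : Fin 2))))^[n] f), ?_⟩
  rw [factorial_mul_coeff_eq_constantCoeff_iterate, iterate_derivative_leafSubst,
    constantCoeff_leafSubst, ← map_iterate_leafDerivation, MvPowerSeries.constantCoeff_map, eq_intCast]

/-- `σ(x₁ʲ) = yʲ`: the powers of the leaf as instances of `σ`. [folklore] -/
theorem leafSubst_X_one_pow (j : ℕ) :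
    (MvPowerSeries.subst
        ![(X : ℚ⟦X⟧), (W'.map (Int.castRingHom ℚ)).formalExp.subst (W.map (Int.castRingHom ℚ)).formalLog]
        (MvPowerSeries.map (Int.castRingHom ℚ) (MvPowerSeries.X 1 ^ j)) : ℚ⟦X⟧) =
      ((W'.map (Int.castRingHom ℚ)).formalExp.subst (W.map (Int.castRingHom ℚ)).formalLog) ^ j := by
  have ha := hasSubst_X_cons_of_constantCoeff _
    ((W.map (Int.castRingHom ℚ)).constantCoeff_formalExp_subst_formalLog (W'.map (Int.castRingHom ℚ)))
  rw [map_pow, MvPowerSeries.map_X, ← MvPowerSeries.coe_substAlgHom ha, map_pow,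
    MvPowerSeries.coe_substAlgHom ha, MvPowerSeries.subst_X ha]
  rfl

/-- **`n!·[xⁿ](yʲ) = p^{⌊n/p⌋}·m`, `m ∈ ℤ`**: the coefficients of the powers of the formal leaf
`y = exp_{W'}(log_W x)` at an odd prime `p` where the Hasse invariants agree.
[cite: Bost2001AlgebraicLeaves, Prop. 3.9 (2)] -/
theorem exists_int_factorial_mul_coeff_pow (hp2 : p ≠ 2)
    (hA : (W.map (Int.castRingHom (ZMod p))).hasseCoeff p =
      (W'.map (Int.castRingHom (ZMod p))).hasseCoeff p) (j n : ℕ) :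
    ∃ m : ℤ, (n.factorial : ℚ) *
        coeff n (((W'.map (Int.castRingHom ℚ)).formalExp.subst (W.map (Int.castRingHom ℚ)).formalLog) ^ j) =
      (p : ℚ) ^ (n / p) * m := by
  have h := exists_int_factorial_mul_coeff_leafSubst p W W' hp2 hA (MvPowerSeries.X 1 ^ j) n
  rwa [leafSubst_X_one_pow] at h

/-- `n!·[xⁿ](yʲ) ∈ ℤ` for all `n, j`, unconditionally. [cite: Bost2001AlgebraicLeaves, Prop. 3.9 (1)] -/
theorem exists_int_factorial_mul_coeff_pow' (j n : ℕ) :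
    ∃ m : ℤ, (n.factorial : ℚ) *
        coeff n (((W'.map (Int.castRingHom ℚ)).formalExp.subst (W.map (Int.castRingHom ℚ)).formalLog) ^ j) =
      m := by
  have h := exists_int_factorial_mul_coeff_leafSubst' W W' (MvPowerSeries.X 1 ^ j) n
  rwa [leafSubst_X_one_pow] at h

end Int

/-! ### The hypothesis in terms of `a_p` -/

section FrobeniusTrace

/-- **`a_p ≡ A_p (mod p)`** for a globally minimal Weierstrass equation `W₀/ℚ` at an odd prime `p`
where the reduction of its integral model is nonsingular: `a_p = p + 1 - #Ẽ(𝔽_p)` reduces to the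
Hasse invariant `A_p` (coefficient of `x^{p-1}` in `Ψ₂²(x)^{(p-1)/2}`) of the reduction. Hence
`a_p(E) = a_p(E')` implies the Hasse hypothesis of `exists_int_factorial_mul_coeff_leafSubst` for
the integral models. [cite: SilvermanAEC2009, V.4.1(a)] -/
theorem intCast_frobeniusTrace_eq_hasseCoeff (W₀ : WeierstrassCurve ℚ) [W₀.IsGloballyMinimal]
    (p : ℕ) [Fact p.Prime] (hp2 : p ≠ 2)
    [((integralModelInt W₀).map (Int.castRingHom (ZMod p))).IsElliptic] :
    ((W₀.frobeniusTrace p : ℤ) : ZMod p) =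
      ((integralModelInt W₀).map (Int.castRingHom (ZMod p))).hasseCoeff p := by
  have h2 : ringChar (ZMod p) ≠ 2 := by rwa [ZMod.ringChar_zmod_n]
  have key := ((integralModelInt W₀).map (Int.castRingHom (ZMod p))).cast_card_add_one_sub_natCard_point h2
  rw [ZMod.card] at key
  rw [frobeniusTrace, reductionPointCount, hasseCoeff]
  exact key

/-- **From `a_p(E) = a_p(E')` to equal Hasse invariants** of the reductions of the integral models
(odd prime `p`, both reductions nonsingular). [cite: SilvermanAEC2009, V.4.1(a)] -/
theorem hasseCoeff_reduction_eq_of_frobeniusTrace_eq (W₀ W₀' : WeierstrassCurve ℚ)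
    [W₀.IsGloballyMinimal] [W₀'.IsGloballyMinimal] (p : ℕ) [Fact p.Prime] (hp2 : p ≠ 2)
    [((integralModelInt W₀).map (Int.castRingHom (ZMod p))).IsElliptic]
    [((integralModelInt W₀').map (Int.castRingHom (ZMod p))).IsElliptic]
    (h : W₀.frobeniusTrace p = W₀'.frobeniusTrace p) :
    ((integralModelInt W₀).map (Int.castRingHom (ZMod p))).hasseCoeff p =
      ((integralModelInt W₀').map (Int.castRingHom (ZMod p))).hasseCoeff p := by
  rw [← intCast_frobeniusTrace_eq_hasseCoeff W₀ p hp2, ← intCast_frobeniusTrace_eq_hasseCoeff W₀' p hp2, h]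

end FrobeniusTrace

end WeierstrassCurve

end
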